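import Summits.CriticalPhenomena.SAWScalingLimit.Theorems.SAWDefectDecoherenceObservableToSLERCarvedReductionSqueezeInnerPrep
import Summits.CriticalPhenomena.SAWScalingLimit.Theorems.SAWDefectDecoherenceObservableToSLERCarvedReductionSqueezeInnerDisc
import HarnessLib

/-!
# Inputs of the boundary trace and the tracking estimate for the inner approximant (piece (K4),
# first half, of stub 5a4″ `stub_carvedReduction_squeezeSolid`)

Piece of stub 5a4″ `stub_carvedReduction_squeezeSolid`
(`TwoPieceAdmRestrictionLimit → MovingCarvingSqueezeP FatAnchoredClassZeroSolid`) of the line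
`bridge-gate-renewal` (r11) of the crux `SAWDefectDecoherence.ObservableToSLER`
(stmt-CriticalPhenomena-14005; twin T-A `stub_carvedReduction_squeezeGeometry` of
stmt-CriticalPhenomena-10472), repaired inner-approximant contract `InnerApproximant2`.  The
assembly of the inner Jordan approximant `M'` of the limit bulk `Ω` (the component of `b₀` in
`D ∖ ⋃ K`, `D` a Dobrushin domain — in the contract the translate `D - τ`) feeds the trace theorem
`stub_carvedReduction_boundaryTrace` with the boundary loop `γ = D.boundary`, the near balls
`B_i = B(D.pt i, η/3)` and the far parameter set `F = [a+s, b-s] ∪ [b+s, a+1-s]` (`a, b` the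
marks).  This file verifies its hypotheses and proves the parameter-wise tracking estimate:

* `far_param_dist` — under (H2) (boundary points `2 rs`-near a marked point have parameters
  `s`-near its mark mod `1`) a far parameter `t ∈ F` has `dist (γ t) (D.pt i) > 2 rs`;
* `frontier_cover` — every point of `∂Ω ⊆ ∂D ∪ ⋃ K` lies in `B₀ ∪ B₁` or is a far value `γ t`,
  `t ∈ F` (reduction of the parameter mod `1`, hypothesis (H1));
* `gate_preimage` — the gate points `E.pt i` of the flat super-domain lie on `∂Ω = ψ̄ (∂𝔻)`;
* `stub_carvedReduction_traceInputs` — far values are one-sided boundary values of the extended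
  uniformizer `ψ̄` with one circle preimage (`stub_carvedReduction_farOneSided`), `γ` is injective
  on `F`, the four window endpoints land in the near balls, and the cover property;
* `loop_tracks` — THE TRACKING ESTIMATE: for the lift `Θ` of `stub_carvedReduction_liftExtension`
  (equal to the far lift `Θ₀` on `F`, windows mapped into the near arcs) the loop
  `t ↦ ψ̄ (e (σ Θ t))` is `2η/3`-close to `γ t` for every parameter `t`.

Sources: Ch. Pommerenke, Boundary Behaviour of Conformal Maps (1992), Thm. 2.6, §2.4.
-/

noncomputable section
open scoped Topology Real
open Filter Set Metric Function Bornology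
open Literature.Probability.RandomPlanarGeometry

namespace Summit.CriticalPhenomena.SAWScalingLimit.Theorems.ObservableToSLER.Squeeze

/-! ### Elementary facts: window points, far parameters, the sign trick on the circle -/

/-- The point `g + ε i` lies in the window `{im > im g} ∩ B(g, ρ)` for `0 < ε < ρ`. -/
theorem window_point (g : ℂ) {ε ρ : ℝ} (hε : 0 < ε) (hερ : ε < ρ) :
    g + (ε : ℂ) * Complex.I ∈ {z : ℂ | g.im < z.im} ∩ ball g ρ := by
  constructor
  · simp only [mem_setOf_eq, Complex.add_im, Complex.mul_im, Complex.ofReal_re, Complex.ofReal_im,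
      Complex.I_re, Complex.I_im]
    linarith
  · rw [mem_ball, dist_eq_norm, add_sub_cancel_left, norm_mul, Complex.norm_real, Complex.norm_I,
      mul_one, Real.norm_eq_abs, abs_of_pos hε]
    exact hερ

/-- **Far parameters are spatially far** from both marked points: under (H2) every
`t ∈ [a+s, b-s] ∪ [b+s, a+1-s]` has `dist (D.boundary t) (D.pt i) > 2 rs` (a far parameter is
`s`-far from both marks mod `1`, using `0 ≤ a < b < 1`). -/
theorem far_param_dist (D : DobrushinDomain) {rs s : ℝ}
    (H2 : ∀ i : Fin 2, ∀ t : ℝ, dist (D.boundary t) (D.pt i) ≤ 2 * rs →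
      ∃ n : ℤ, |t - D.mark i - n| < s)
    {t : ℝ} (ht : t ∈ Icc (D.mark 0 + s) (D.mark 1 - s) ∪ Icc (D.mark 1 + s) (D.mark 0 + 1 - s)) :
    ∀ i : Fin 2, 2 * rs < dist (D.boundary t) (D.pt i) := by
  have h0 := (D.mark_mem 0).1
  have h1 := (D.mark_mem 1).2
  have h01 : D.mark 0 < D.mark 1 := D.strictMono_mark (show (0 : Fin 2) < 1 by decide)
  have ht0 : D.mark 0 + s ≤ t ∧ t ≤ D.mark 0 + 1 - s := by
    rcases ht with ht | ht
    · exact ⟨ht.1, by linarith [ht.2]⟩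
    · exact ⟨by linarith [ht.1], ht.2⟩
  have ht1 : t ≤ D.mark 1 - s ∨ D.mark 1 + s ≤ t := by
    rcases ht with ht | ht
    · exact Or.inl ht.2
    · exact Or.inr ht.1
  have key : ∀ i : Fin 2, ∀ n : ℤ, s ≤ |t - D.mark i - n| := by
    refine Fin.forall_fin_two.2 ⟨fun n => ?_, fun n => ?_⟩
    · rcases le_or_gt n 0 with hn | hn
      · have hn' : (n : ℝ) ≤ 0 := by exact_mod_cast hn
        exact le_abs.2 (Or.inl (by linarith [ht0.1]))
      · have hn' : (1 : ℝ) ≤ n := by exact_mod_cast hn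
        exact le_abs.2 (Or.inr (by linarith [ht0.2]))
    · rcases lt_trichotomy n 0 with hn | rfl | hn
      · have hn' : (n : ℝ) ≤ -1 := by
          have : n ≤ -1 := by omega
          exact_mod_cast this
        exact le_abs.2 (Or.inl (by linarith [ht0.1]))
      · rcases ht1 with h | h
        · exact le_abs.2 (Or.inr (by push_cast; linarith))
        · exact le_abs.2 (Or.inl (by push_cast; linarith))
      · have hn' : (1 : ℝ) ≤ n := by exact_mod_cast hn
        exact le_abs.2 (Or.inr (by linarith [ht0.2]))
  intro i
  by_contra hle
  push Not at hle
  obtain ⟨n, hn⟩ := H2 i t hle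
  exact (lt_irrefl s) ((key i n).trans_lt hn)

/-- The sign trick: `e (σ (θ + 1)) = e (σ θ)` for `σ = ±1` (`e θ = circleMap 0 1 (2πθ)`). -/
theorem circleMap_sign_add_one {σ : ℝ} (hσ : σ = 1 ∨ σ = -1) (θ : ℝ) :
    circleMap 0 1 (2 * π * (σ * (θ + 1))) = circleMap 0 1 (2 * π * (σ * θ)) := by
  obtain ⟨n, hn⟩ : ∃ n : ℤ, (n : ℝ) = σ := by
    rcases hσ with h | h
    · exact ⟨1, by rw [h, Int.cast_one]⟩
    · exact ⟨-1, by rw [h, Int.cast_neg, Int.cast_one]⟩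
  rw [show σ * (θ + 1) = σ * θ + n by rw [hn]; ring]
  exact circleMap_two_pi_add_int (σ * θ) n

/-! ### The frontier of the bulk: near balls or far values -/

/-- **Cover of the frontier of the bulk.**  Let `Ω` be the component of `b₀` in `D ∖ ⋃ K` with the
carvings `K k` closed and inside `⋃ B(D.pt i, rs/2)`, `rs ≤ η/6`, and (H1): parameters `s`-near a
mark are mapped `η/3`-near the marked point.  Then every point of `∂Ω` lies in
`B(D.pt 0, η/3) ∪ B(D.pt 1, η/3)` or equals `D.boundary t` for a far parameter
`t ∈ [a+s, b-s] ∪ [b+s, a+1-s]` (`∂Ω ⊆ ∂(D ∖ ⋃ K) ⊆ ∂D ∪ ⋃ K`, `∂D = γ(ℝ)`, reduction of the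
parameter into `[a-s, a+1-s)`). -/
theorem frontier_cover (D : DobrushinDomain) {m : ℕ} (K : Fin m → Set ℂ) (b₀ : ℂ) {rs η s : ℝ}
    (hKc : ∀ k, IsClosed (K k)) (hKball : ∀ k, K k ⊆ ⋃ i : Fin 2, ball (D.pt i) (rs / 2))
    (hrs : 0 < rs) (hrsη : rs ≤ η / 6) (hs : 0 < s)
    (H1 : ∀ i : Fin 2, ∀ t : ℝ, |t - D.mark i| ≤ s → dist (D.boundary t) (D.pt i) < η / 3)
    {w : ℂ} (hw : w ∈ frontier (connectedComponentIn (D.carrier \ ⋃ k, K k) b₀)) :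
    w ∈ ball (D.pt 0) (η / 3) ∪ ball (D.pt 1) (η / 3) ∨
      ∃ t ∈ Icc (D.mark 0 + s) (D.mark 1 - s) ∪ Icc (D.mark 1 + s) (D.mark 0 + 1 - s),
        w = D.boundary t := by
  have hKcl : IsClosed (⋃ k, K k) := isClosed_iUnion_of_finite hKc
  have hUo : IsOpen (D.carrier \ ⋃ k, K k) := D.isOpen.sdiff hKcl
  have hw1 : w ∈ frontier (D.carrier \ ⋃ k, K k) :=
    stub_carvedReduction_componentFrontier _ b₀ hUo hw
  rw [Set.sdiff_eq_compl_inter] at hw1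
  rcases frontier_inter_subset _ _ hw1 with ⟨hwK, -⟩ | ⟨-, hwD⟩
  · rw [frontier_compl] at hwK
    obtain ⟨k, hk⟩ := mem_iUnion.1 (hKcl.frontier_subset hwK)
    rcases Fin.exists_fin_two.1 (mem_iUnion.1 (hKball k hk)) with h | h
    · exact Or.inl (Or.inl (ball_subset_ball (by linarith) h))
    · exact Or.inl (Or.inr (ball_subset_ball (by linarith) h))
  · rw [← D.range_boundary] at hwD
    obtain ⟨t₀, rfl⟩ := hwD
    obtain ⟨t, ht, hteq⟩ := D.periodic_boundary.exists_mem_Ico one_pos t₀ (D.mark 0 - s)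
    rw [hteq]
    rcases le_or_gt t (D.mark 0 + s) with h₁ | h₁
    · exact Or.inl (Or.inl (mem_ball.2 (H1 0 t (abs_le.2 ⟨by linarith [ht.1], by linarith⟩))))
    rcases le_or_gt t (D.mark 1 - s) with h₂ | h₂
    · exact Or.inr ⟨t, Or.inl ⟨h₁.le, h₂⟩, rfl⟩
    rcases lt_or_ge t (D.mark 1 + s) with h₃ | h₃
    · exact Or.inl (Or.inr (mem_ball.2 (H1 1 t (abs_le.2 ⟨by linarith, by linarith⟩))))
    rcases le_or_gt t (D.mark 0 + 1 - s) with h₄ | h₄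
    · exact Or.inr ⟨t, Or.inr ⟨h₃, h₄⟩, rfl⟩
    · refine Or.inl (Or.inl (mem_ball.2 ?_))
      rw [← D.periodic_boundary.sub_eq t]
      exact H1 0 (t - 1) (abs_le.2 ⟨by linarith, by linarith [ht.2]⟩)

/-! ### Gate preimages on the circle -/

section Bulk

variable {Ω : Set ℂ} (ψ : ConformalEquiv (ball (0 : ℂ) 1) Ω)

/-- **Gate preimages.**  If the windows `{im > im E.pt i} ∩ B(E.pt i, ρE)` lie in the open set
`Ω ⊆ E`, the gate point `E.pt i` is a frontier point of `Ω`, hence a value of the extended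
uniformizer `ψ̄` on the unit circle (`ψ̄ (∂𝔻) = ∂Ω`). -/
theorem gate_preimage (E : DobrushinDomain) {ρE : ℝ} (hΩo : IsOpen Ω)
    (hΦc : ContinuousOn (extendFrom (ball 0 1) ψ) (closedBall (0 : ℂ) 1))
    (htend : ∀ x ∈ closedBall (0 : ℂ) 1,
      Tendsto ψ (𝓝[ball 0 1] x) (𝓝 (extendFrom (ball 0 1) ψ x)))
    (hρE : 0 < ρE) (hwin : ∀ i : Fin 2, {z : ℂ | (E.pt i).im < z.im} ∩ ball (E.pt i) ρE ⊆ Ω)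
    (hΩE : Ω ⊆ E.carrier) (i : Fin 2) :
    ∃ ζ : ℂ, ‖ζ‖ = 1 ∧ extendFrom (ball 0 1) ψ ζ = E.pt i := by
  have hfr : E.pt i ∈ frontier Ω := by
    rw [hΩo.frontier_eq]
    refine ⟨Metric.mem_closure_iff.2 fun ε hε => ?_, fun h => ?_⟩
    · have hlt : min (ε / 2) (ρE / 2) < ρE := (min_le_right _ _).trans_lt (half_lt_self hρE)
      refine ⟨_, hwin i (window_point (E.pt i) (by positivity) hlt), ?_⟩
      rw [dist_comm, dist_eq_norm, add_sub_cancel_left, norm_mul, Complex.norm_real, Complex.norm_I,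
        mul_one, Real.norm_eq_abs, abs_of_pos (by positivity)]
      exact (min_le_left _ _).trans_lt (half_lt_self hε)
    · have h1 : E.pt i ∈ frontier E.carrier := E.pt_mem_frontier i
      rw [E.isOpen.frontier_eq] at h1
      exact h1.2 (hΩE h)
  rw [← image_extendFrom_sphere' ψ hΩo hΦc htend] at hfr
  obtain ⟨ζ, hζ, hζe⟩ := hfr
  exact ⟨ζ, mem_sphere_zero_iff_norm.1 hζ, hζe⟩

/-! ### The inputs of the trace theorem -/

/-- **Registered sub-goal `stub_carvedReduction_traceInputs`** (crux item stmt-CriticalPhenomena-14005,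
stub 5a4″ `stub_carvedReduction_squeezeSolid`, piece (K4) ASSEMBLY, trace inputs): let `Ω` be
the component of `b₀` in `D ∖ ⋃ K` (carvings closed, inside `⋃ B(D.pt i, rs/2)`), open and
bounded with preconnected complement and the uniform-continuum clause, with a disc uniformizer
`ψ` whose extension `ψ̄` is continuous on the closed disc; assume no long fingers at radius `rs`
(`D ∖ ⋃ B̄(D.pt i, rs) ⊆ Ω`), `rs ≤ η/6`, a parameter window `s` with (H1), (H2).  Then on the
far parameter set `F = [a+s, b-s] ∪ [b+s, a+1-s]`: every `D.boundary t` is a circle value of `ψ̄`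
with exactly one circle preimage and is `> 2 rs` away from both marked points; `D.boundary` is
injective on `F`; the four window endpoints are mapped into the near balls `B(D.pt i, η/3)`;
and every circle value of `ψ̄` lies in a near ball or is a far value. [cite: PommerenkeBBCM1992, Thm. 2.6] -/
theorem stub_carvedReduction_traceInputs :
    ∀ (D : DobrushinDomain) (m : ℕ) (K : Fin m → Set ℂ) (b₀ : ℂ) (Ω : Set ℂ)
      (ψ : ConformalEquiv (ball (0 : ℂ) 1) Ω) (rs η s : ℝ),
      Ω = connectedComponentIn (D.carrier \ ⋃ k, K k) b₀ →
      IsOpen Ω → IsBounded Ω → IsPreconnected Ωᶜ →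
      (∀ ε > (0 : ℝ), ∃ δ > (0 : ℝ), ∀ a ∈ frontier Ω, ∀ b ∈ frontier Ω, dist a b < δ →
        ∃ σ ⊆ Ωᶜ, IsCompact σ ∧ IsPreconnected σ ∧ a ∈ σ ∧ b ∈ σ ∧ σ ⊆ closedBall a ε) →
      ContinuousOn (extendFrom (ball 0 1) ψ) (closedBall (0 : ℂ) 1) →
      (∀ x ∈ closedBall (0 : ℂ) 1, Tendsto ψ (𝓝[ball 0 1] x) (𝓝 (extendFrom (ball 0 1) ψ x))) →
      0 < rs → rs ≤ η / 6 → 0 < s → D.mark 0 + s < D.mark 1 - s → D.mark 1 + s < D.mark 0 + 1 - s →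
      (∀ i : Fin 2, ∀ t : ℝ, |t - D.mark i| ≤ s → dist (D.boundary t) (D.pt i) < η / 3) →
      (∀ i : Fin 2, ∀ t : ℝ, dist (D.boundary t) (D.pt i) ≤ 2 * rs →
        ∃ n : ℤ, |t - D.mark i - n| < s) →
      (∀ k, IsClosed (K k)) → (∀ k, K k ⊆ ⋃ i : Fin 2, ball (D.pt i) (rs / 2)) →
      D.carrier \ (⋃ i : Fin 2, closedBall (D.pt i) rs) ⊆ Ω →
      let F : Set ℝ := Icc (D.mark 0 + s) (D.mark 1 - s) ∪ Icc (D.mark 1 + s) (D.mark 0 + 1 - s)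
      (∀ t ∈ F, D.boundary t ∈ extendFrom (ball 0 1) ψ '' sphere 0 1 ∧
        (sphere (0 : ℂ) 1 ∩ extendFrom (ball 0 1) ψ ⁻¹' {D.boundary t}).Subsingleton) ∧
      (∀ t ∈ F, ∀ i : Fin 2, 2 * rs < dist (D.boundary t) (D.pt i)) ∧
      InjOn D.boundary F ∧
      D.boundary (D.mark 0 + s) ∈ ball (D.pt 0) (η / 3) ∧
      D.boundary (D.mark 0 + 1 - s) ∈ ball (D.pt 0) (η / 3) ∧
      D.boundary (D.mark 1 - s) ∈ ball (D.pt 1) (η / 3) ∧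
      D.boundary (D.mark 1 + s) ∈ ball (D.pt 1) (η / 3) ∧
      (∀ ζ ∈ sphere (0 : ℂ) 1,
        extendFrom (ball 0 1) ψ ζ ∈ ball (D.pt 0) (η / 3) ∪ ball (D.pt 1) (η / 3) ∨
          ∃ t ∈ F, extendFrom (ball 0 1) ψ ζ = D.boundary t) := by
  intro D m K b₀ Ω ψ rs η s hΩdef hΩo hΩb hΩpc hlc hΦc htend hrs hrsη hs hab hba H1 H2 hKc hKball
    hfing F
  have hΩD : Ω ⊆ D.carrier := by
    rw [hΩdef]; exact (connectedComponentIn_subset _ _).trans Set.sdiff_subset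
  have hfar2 : ∀ t ∈ F, ∀ i : Fin 2, 2 * rs < dist (D.boundary t) (D.pt i) :=
    fun t ht => far_param_dist D H2 ht
  refine ⟨fun t ht => ?_, hfar2, ?_, ?_, ?_, ?_, ?_, fun ζ hζ => ?_⟩
  · -- far values are one-sided
    have hdisj : Disjoint (ball (D.boundary t) rs) (⋃ i : Fin 2, closedBall (D.pt i) rs) := by
      rw [disjoint_iUnion_right]
      intro i
      rw [disjoint_left]
      intro z hz hz'
      have h := hfar2 t ht i
      have h3 := dist_triangle_left (D.boundary t) (D.pt i) z
      linarith [mem_ball.1 hz, mem_closedBall.1 hz']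
    obtain ⟨hfr, hsub⟩ := stub_carvedReduction_farOneSided D Ω (⋃ i : Fin 2, closedBall (D.pt i) rs)
      ψ rs hΩD hΩo hΩb hΩpc hlc hΦc htend hrs hfing (D.boundary t) (D.boundary_mem_frontier t) hdisj
    refine ⟨?_, hsub⟩
    rw [image_extendFrom_sphere' ψ hΩo hΦc htend]
    exact hfr
  · -- injectivity on the far set: `F ⊆ [a, a + 1)`
    refine (D.injOn_boundary_Ico (D.mark 0)).mono fun t ht => ?_
    rcases ht with ht | ht
    · exact ⟨by linarith [ht.1], by linarith [ht.2]⟩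
    · exact ⟨by linarith [ht.1], by linarith [ht.2]⟩
  · exact mem_ball.2 (H1 0 _ (by rw [add_sub_cancel_left, abs_of_pos hs]))
  · rw [show D.mark 0 + 1 - s = D.mark 0 - s + 1 by ring, D.periodic_boundary]
    exact mem_ball.2 (H1 0 _
      (by rw [show D.mark 0 - s - D.mark 0 = -s by ring, abs_neg, abs_of_pos hs]))
  · exact mem_ball.2 (H1 1 _
      (by rw [show D.mark 1 - s - D.mark 1 = -s by ring, abs_neg, abs_of_pos hs]))
  · exact mem_ball.2 (H1 1 _ (by rw [add_sub_cancel_left, abs_of_pos hs]))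
  · -- cover: `ψ̄ ζ ∈ ∂Ω`
    have hfr : extendFrom (ball 0 1) ψ ζ ∈ frontier Ω := by
      rw [← image_extendFrom_sphere' ψ hΩo hΦc htend]
      exact ⟨ζ, hζ, rfl⟩
    refine frontier_cover D K b₀ hKc hKball hrs hrsη hs H1 (w := extendFrom (ball 0 1) ψ ζ) ?_
    rw [← hΩdef]
    exact hfr

end Bulk

/-! ### The tracking estimate -/

/-- **The loop of the inner domain tracks the target loop.**  Let `γ` be `1`-periodic, `σ = ±1`,
(H1) near parameters mapped `η/3`-near the marked points `p₀`, `p₁`, the far identity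
`Φ (e (σ Θ₀ t)) = γ t` on `F = [a+s, b-s] ∪ [b+s, a+1-s]`, the gap clauses of the trace theorem
(near arcs mapped into `B(p_i, η/3)`), and a lift `Θ` with `Θ (t + 1) = Θ t + 1`, `Θ = Θ₀` on
`F`, mapping the windows `[b-s, b+s]`, `[a+1-s, a+1+s]` into the near arcs.  Then
`dist (Φ (e (σ Θ t))) (γ t) < 2η/3` for every `t` (reduce `t` into `[a-s, a+1-s)` by
periodicity; far parameters give distance `0`, near ones `η/3 + η/3`). -/
theorem loop_tracks {Φ : ℂ → ℂ} {γ : ℝ → ℂ} {p₀ p₁ : ℂ} {a b s c σ η : ℝ} {Θ₀ Θ : ℝ → ℝ}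
    (hγ : Function.Periodic γ 1) (hσ : σ = 1 ∨ σ = -1) (hη : 0 < η)
    (H1₀ : ∀ t, |t - a| ≤ s → dist (γ t) p₀ < η / 3)
    (H1₁ : ∀ t, |t - b| ≤ s → dist (γ t) p₁ < η / 3)
    (hfar : ∀ t ∈ Icc (a + s) (b - s) ∪ Icc (b + s) (a + 1 - s),
      Φ (circleMap 0 1 (2 * π * (σ * Θ₀ t))) = γ t)
    (hgap₁ : ∀ θ ∈ Icc (Θ₀ (b - s)) (Θ₀ (b + s)),
      Φ (circleMap 0 1 (2 * π * (σ * θ))) ∈ ball p₁ (η / 3))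
    (hgap₀ : ∀ θ ∈ Icc c (Θ₀ (a + s)) ∪ Icc (Θ₀ (a + 1 - s)) (c + 1),
      Φ (circleMap 0 1 (2 * π * (σ * θ))) ∈ ball p₀ (η / 3))
    (hper : ∀ t, Θ (t + 1) = Θ t + 1)
    (heq : EqOn Θ Θ₀ (Icc (a + s) (b - s) ∪ Icc (b + s) (a + 1 - s)))
    (hwb : ∀ t ∈ Icc (b - s) (b + s), Θ t ∈ Icc (Θ₀ (b - s)) (Θ₀ (b + s)))
    (hwa : ∀ t ∈ Icc (a + 1 - s) (a + 1 + s), Θ t ∈ Icc (Θ₀ (a + 1 - s)) (Θ₀ (a + s) + 1))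
    (t : ℝ) : dist (Φ (circleMap 0 1 (2 * π * (σ * Θ t)))) (γ t) < 2 * η / 3 := by
  -- one period of parameters
  have key : ∀ u ∈ Ico (a - s) (a - s + 1),
      dist (Φ (circleMap 0 1 (2 * π * (σ * Θ u)))) (γ u) < 2 * η / 3 := by
    intro u hu
    rcases le_or_gt u (a + s) with h₁ | h₁
    · -- near the first mark: go through the shifted window `[a+1-s, a+1+s]`
      have hγu : dist (γ u) p₀ < η / 3 := H1₀ u (abs_le.2 ⟨by linarith [hu.1], by linarith⟩)
      have hwin := hwa (u + 1) ⟨by linarith [hu.1], by linarith⟩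
      have hΦu : Φ (circleMap 0 1 (2 * π * (σ * Θ u))) ∈ ball p₀ (η / 3) := by
        rcases le_or_gt (Θ (u + 1)) (c + 1) with h₂ | h₂
        · rw [show Θ u = Θ (u + 1) - 1 by rw [hper u]; ring,
            ← circleMap_sign_add_one hσ (Θ (u + 1) - 1), sub_add_cancel]
          exact hgap₀ _ (Or.inr ⟨hwin.1, h₂⟩)
        · refine hgap₀ _ (Or.inl ⟨?_, ?_⟩)
          · have := hper u
            linarith
          · have := hper u
            linarith [hwin.2]
      calc dist (Φ (circleMap 0 1 (2 * π * (σ * Θ u)))) (γ u)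
          ≤ dist (Φ (circleMap 0 1 (2 * π * (σ * Θ u)))) p₀ + dist (γ u) p₀ :=
            dist_triangle_right _ _ _
        _ < η / 3 + η / 3 := add_lt_add (mem_ball.1 hΦu) hγu
        _ = 2 * η / 3 := by ring
    rcases le_or_gt u (b - s) with h₂ | h₂
    · have hmem : u ∈ Icc (a + s) (b - s) ∪ Icc (b + s) (a + 1 - s) := Or.inl ⟨h₁.le, h₂⟩
      rw [heq hmem, hfar u hmem, dist_self]
      positivity
    rcases lt_or_ge u (b + s) with h₃ | h₃
    · -- near the second mark
      have hγu : dist (γ u) p₁ < η / 3 := H1₁ u (abs_le.2 ⟨by linarith, by linarith⟩)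
      have hΦu := hgap₁ _ (hwb u ⟨h₂.le, h₃.le⟩)
      calc dist (Φ (circleMap 0 1 (2 * π * (σ * Θ u)))) (γ u)
          ≤ dist (Φ (circleMap 0 1 (2 * π * (σ * Θ u)))) p₁ + dist (γ u) p₁ :=
            dist_triangle_right _ _ _
        _ < η / 3 + η / 3 := add_lt_add (mem_ball.1 hΦu) hγu
        _ = 2 * η / 3 := by ring
    · have hmem : u ∈ Icc (a + s) (b - s) ∪ Icc (b + s) (a + 1 - s) :=
        Or.inr ⟨h₃, by linarith [hu.2]⟩
      rw [heq hmem, hfar u hmem, dist_self]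
      positivity
  -- periodicity of the tracked distance
  have hgp : Function.Periodic
      (fun t => dist (Φ (circleMap 0 1 (2 * π * (σ * Θ t)))) (γ t)) 1 := by
    intro x
    simp only []
    rw [hper x, hγ x, circleMap_sign_add_one hσ]
  obtain ⟨u, hu, hgu⟩ := hgp.exists_mem_Ico one_pos t (a - s)
  exact (le_of_eq hgu).trans_lt (key u hu)

end Summit.CriticalPhenomena.SAWScalingLimit.Theorems.ObservableToSLER.Squeeze

end
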